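import Mathlib
import Summits.PneNP.PneNP.Theorems.OverlapGapAlgebraSolvableImpliesStableSectionUnitClauseClassify
import Summits.PneNP.PneNP.Theorems.OverlapGapAlgebraSolvableImpliesStableSectionUnitClauseCollisions
import Summits.PneNP.PneNP.Theorems.OverlapGapAlgebraSolvableImpliesStableSectionUnitClauseContradictions

/-!
# PneNP / OverlapGapAlgebra — crux `SolvableImpliesStableSection` (stmt-PneNP-2463):
# the UNIT CLAUSE block (14/·) — the mean number of violated clauses

Support for crux `stmt-PneNP-2463` (`Summit.PneNP.PneNP.Theses.OverlapGapAlgebra.SolvableImpliesStableSection`),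
registered stub `stub_lowDensity` (child G).  Summed over all instances, the clauses violated by the
section `v ↦ (st ∅ R Φ v).getD true` of the localized unit-clause dynamics are at most the
contradiction pairs (kind A, `sissU_sum_cpairs_le`), the collisions (kind B,
`sissU_sum_collision_indicator_le` with the second moment of the newly set variables) and the
degenerate clauses (kind C, `sissU_sum_degenerate_indicator_le`), by `sissU_violated_classify`:
`Σ_Φ #viol ≤ [R·m²·K·K₂·Q/#C² + R·m·(k²-k)·4(2n)^{k-2}·Q/#C + m·(k²-k)·2(2n)^{k-1}/#C]·#Ω`,
`Q = W² + 2Wa + q`, where `a`, `q` are the first/second-moment levels (`sissU_sum_unit_le`,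
`sissU_sum_unit_sq_le`).  With `W, a = O(n/R)`, `q = O(n²/R²)` this is `O_{k,α}(n/R + 1)·#Ω`.

* `sissU_card_violated_le` (pointwise classification count), `sissU_sum_violated_le`.
All objects are hypotheses; no definitions; axioms `propext`, `Classical.choice`, `Quot.sound`.
-/

set_option linter.dupNamespace false -- `Summit.PneNP.PneNP.…`: summit = sub-problem (D-0017)

namespace Summit.PneNP.PneNP.Theorems

open Finset
open scoped Classical

section Mean

variable {m k n : ℕ} {R : ℕ}
  (st : Finset (Fin m) → ℕ → (Fin m → Fin k → Fin n × Bool) → Fin n → Option Bool)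
  (dm : Finset (Fin m) → ℕ → (Fin m → Fin k → Fin n × Bool) → Fin n → Bool)
  (h0 : ∀ (S : Finset (Fin m)) (Φ : Fin m → Fin k → Fin n × Bool) (v : Fin n), st S 0 Φ v = none)
  (hstep : ∀ (S : Finset (Fin m)) (t : ℕ) (Φ : Fin m → Fin k → Fin n × Bool) (v : Fin n),
    st S (t + 1) Φ v =
      if st S t Φ v = none then
        (if ∃ i : Fin m, i ∉ S ∧ ∃ j : Fin k, (Φ i j).1 = v ∧ ∀ j' : Fin k, j' ≠ j →
            st S t Φ (Φ i j').1 ≠ none ∧ st S t Φ (Φ i j').1 ≠ some (Φ i j').2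
          then some (dm S t Φ v)
          else if (v : ℕ) * R / n = t then some true else none)
      else st S t Φ v)
  (hdm : ∀ (S : Finset (Fin m)) (t : ℕ) (Φ : Fin m → Fin k → Fin n × Bool) (v : Fin n) (i : Fin m)
    (j : Fin k), i ∉ S → (Φ i j).1 = v → st S t Φ v = none →
    (∀ j' : Fin k, j' ≠ j → st S t Φ (Φ i j').1 ≠ none ∧ st S t Φ (Φ i j').1 ≠ some (Φ i j').2) →
    (∀ i' : Fin m, i' ∉ S → (∃ j₁ : Fin k, (Φ i' j₁).1 = v ∧ ∀ j' : Fin k, j' ≠ j₁ →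
      st S t Φ (Φ i' j').1 ≠ none ∧ st S t Φ (Φ i' j').1 ≠ some (Φ i' j').2) → i ≤ i') →
    dm S t Φ v = (Φ i j).2)

include h0 hstep hdm in
/-- **Violated clauses, pointwise.** For `k, R ≥ 1`, the number of clauses violated by the section
`v ↦ (st ∅ R Φ v).getD true` is at most the contradiction pairs over the rounds (as ordered pairs
`(i, i')`, `i ≠ i'`, both unit on one variable), plus the collisions over the rounds, plus the
degenerate clauses. -/
theorem sissU_card_violated_le (hk : 1 ≤ k) (hR : 1 ≤ R) (Φ : Fin m → Fin k → Fin n × Bool) :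
    (((univ : Finset (Fin m)).filter fun i => ∀ j : Fin k,
        (st ∅ R Φ (Φ i j).1).getD true ≠ (Φ i j).2).card : ℝ)
      ≤ (∑ t ∈ range R, ∑ i : Fin m, ∑ i' : Fin m,
          (if i ≠ i' ∧ ∃ v : Fin n,
              (∃ j : Fin k, (Φ i j).1 = v ∧ st ∅ t Φ v = none ∧ ∀ j' : Fin k, j' ≠ j →
                st ∅ t Φ (Φ i j').1 ≠ none ∧ st ∅ t Φ (Φ i j').1 ≠ some (Φ i j').2) ∧
              (∃ j : Fin k, (Φ i' j).1 = v ∧ st ∅ t Φ v = none ∧ ∀ j' : Fin k, j' ≠ j →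
                st ∅ t Φ (Φ i' j').1 ≠ none ∧ st ∅ t Φ (Φ i' j').1 ≠ some (Φ i' j').2)
            then (1 : ℝ) else 0)) +
        (∑ t ∈ range R, ∑ i : Fin m,
          (if ∃ j j' : Fin k, (Φ i j).1 ≠ (Φ i j').1 ∧ st ∅ t Φ (Φ i j).1 = none ∧ st ∅ t Φ (Φ i j').1 = none ∧
              st ∅ (t + 1) Φ (Φ i j).1 ≠ none ∧ st ∅ (t + 1) Φ (Φ i j').1 ≠ none then (1 : ℝ) else 0)) +
        ∑ i : Fin m, (if ∃ j j' : Fin k, j ≠ j' ∧ (Φ i j).1 = (Φ i j').1 then (1 : ℝ) else 0) := by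
  -- the three kinds
  set V := (univ : Finset (Fin m)).filter fun i => ∀ j : Fin k, (st ∅ R Φ (Φ i j).1).getD true ≠ (Φ i j).2
    with hV
  set FA := (univ : Finset (Fin m)).filter fun i => ∃ t : ℕ, t < R ∧ ∃ v : Fin n, ∃ i' : Fin m, i' ≠ i ∧
      (∃ j : Fin k, (Φ i j).1 = v ∧ st ∅ t Φ v = none ∧ ∀ j' : Fin k, j' ≠ j →
        st ∅ t Φ (Φ i j').1 ≠ none ∧ st ∅ t Φ (Φ i j').1 ≠ some (Φ i j').2) ∧
      (∃ j : Fin k, (Φ i' j).1 = v ∧ st ∅ t Φ v = none ∧ ∀ j' : Fin k, j' ≠ j →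
        st ∅ t Φ (Φ i' j').1 ≠ none ∧ st ∅ t Φ (Φ i' j').1 ≠ some (Φ i' j').2) with hFA
  set FB := (univ : Finset (Fin m)).filter fun i => ∃ t : ℕ, t < R ∧ ∃ j j' : Fin k, (Φ i j).1 ≠ (Φ i j').1 ∧
      st ∅ t Φ (Φ i j).1 = none ∧ st ∅ t Φ (Φ i j').1 = none ∧
      st ∅ (t + 1) Φ (Φ i j).1 ≠ none ∧ st ∅ (t + 1) Φ (Φ i j').1 ≠ none with hFB
  set FC := (univ : Finset (Fin m)).filter fun i => ∃ j j' : Fin k, j ≠ j' ∧ (Φ i j).1 = (Φ i j').1 with hFC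
  have hsub : V ⊆ FA ∪ FB ∪ FC := by
    intro i hi
    rw [hV, mem_filter] at hi
    have hviol : ∀ j : Fin k, st ∅ R Φ (Φ i j).1 ≠ some (Φ i j).2 := by
      intro j h
      have := hi.2 j
      rw [h, Option.getD_some] at this
      exact this rfl
    rcases sissU_violated_classify st dm h0 hstep hdm hk hR Φ i hviol with hA | hB | hC
    · refine mem_union_left _ (mem_union_left _ ?_)
      rw [hFA, mem_filter]; exact ⟨mem_univ _, hA⟩
    · refine mem_union_left _ (mem_union_right _ ?_)
      rw [hFB, mem_filter]; exact ⟨mem_univ _, hB⟩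
    · refine mem_union_right _ ?_
      rw [hFC, mem_filter]; exact ⟨mem_univ _, hC⟩
  have hcard : V.card ≤ FA.card + FB.card + FC.card :=
    (card_le_card hsub).trans ((card_union_le _ _).trans (Nat.add_le_add_right (card_union_le _ _) _))
  have hcardR : (V.card : ℝ) ≤ (FA.card : ℝ) + FB.card + FC.card := by exact_mod_cast hcard
  refine hcardR.trans (add_le_add (add_le_add ?_ ?_) (le_of_eq ?_))
  · -- kind A
    rw [hFA, ← sum_boole (R := ℝ), sum_comm]
    refine sum_le_sum fun i _ => ?_
    split_ifs with h
    · obtain ⟨t, ht, v, i', hi'i, hu, hu'⟩ := h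
      have hnn : ∀ t' ∈ range R, (0 : ℝ) ≤ ∑ i'' : Fin m,
          (if i ≠ i'' ∧ ∃ v : Fin n,
              (∃ j : Fin k, (Φ i j).1 = v ∧ st ∅ t' Φ v = none ∧ ∀ j' : Fin k, j' ≠ j →
                st ∅ t' Φ (Φ i j').1 ≠ none ∧ st ∅ t' Φ (Φ i j').1 ≠ some (Φ i j').2) ∧
              (∃ j : Fin k, (Φ i'' j).1 = v ∧ st ∅ t' Φ v = none ∧ ∀ j' : Fin k, j' ≠ j →
                st ∅ t' Φ (Φ i'' j').1 ≠ none ∧ st ∅ t' Φ (Φ i'' j').1 ≠ some (Φ i'' j').2)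
            then (1 : ℝ) else 0) := fun t' _ => sum_nonneg fun i'' _ => by split_ifs <;> norm_num
      refine le_trans ?_ (single_le_sum hnn (mem_range.mpr ht))
      have hnn' : ∀ i'' ∈ (univ : Finset (Fin m)), (0 : ℝ) ≤
          (if i ≠ i'' ∧ ∃ v : Fin n,
              (∃ j : Fin k, (Φ i j).1 = v ∧ st ∅ t Φ v = none ∧ ∀ j' : Fin k, j' ≠ j →
                st ∅ t Φ (Φ i j').1 ≠ none ∧ st ∅ t Φ (Φ i j').1 ≠ some (Φ i j').2) ∧
              (∃ j : Fin k, (Φ i'' j).1 = v ∧ st ∅ t Φ v = none ∧ ∀ j' : Fin k, j' ≠ j →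
                st ∅ t Φ (Φ i'' j').1 ≠ none ∧ st ∅ t Φ (Φ i'' j').1 ≠ some (Φ i'' j').2)
            then (1 : ℝ) else 0) := fun i'' _ => by split_ifs <;> norm_num
      refine le_trans (le_of_eq ?_) (single_le_sum hnn' (mem_univ i'))
      rw [if_pos ⟨hi'i.symm, v, hu, hu'⟩]
    · exact sum_nonneg fun t' _ => sum_nonneg fun i'' _ => by split_ifs <;> norm_num
  · -- kind B
    rw [hFB, ← sum_boole (R := ℝ), sum_comm]
    refine sum_le_sum fun i _ => ?_
    split_ifs with h
    · obtain ⟨t, ht, hcoll⟩ := h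
      have hnn : ∀ t' ∈ range R, (0 : ℝ) ≤
          (if ∃ j j' : Fin k, (Φ i j).1 ≠ (Φ i j').1 ∧ st ∅ t' Φ (Φ i j).1 = none ∧ st ∅ t' Φ (Φ i j').1 = none ∧
              st ∅ (t' + 1) Φ (Φ i j).1 ≠ none ∧ st ∅ (t' + 1) Φ (Φ i j').1 ≠ none then (1 : ℝ) else 0) :=
        fun t' _ => by split_ifs <;> norm_num
      refine le_trans (le_of_eq ?_) (single_le_sum hnn (mem_range.mpr ht))
      rw [if_pos hcoll]
    · exact sum_nonneg fun t' _ => by split_ifs <;> norm_num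
  · -- kind C
    rw [hFC, ← sum_boole (R := ℝ)]

end Mean

section Main

variable {m k n : ℕ} {R : ℕ}

/-- **The mean number of violated clauses.** With first/second-moment levels `a`, `q` (uniform in the
muted set, `sissU_sum_unit_le` / `sissU_sum_unit_sq_le`), window bound `W`, and `M` as in
`sissU_sum_unit_succ_le` (`k ≥ 2`, `n, R ≥ 1`), the section `v ↦ (st ∅ R Φ v).getD true` violates,
summed over all instances, at most
`[R·m²·K·K₂·Q/#C² + R·m·(k²-k)·4(2n)^{k-2}·Q/#C + m·(k²-k)·2(2n)^{k-1}/#C]·#Ω` clauses,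
`Q = W² + 2Wa + q`, `K = (k²-k)·2M·n^{k-1}`, `K₂ = k²(k²-k)·2·n^{k-2}`, `#C = #(Fin k → Fin n × Bool)`. -/
theorem sissU_sum_violated_le
    (st : Finset (Fin m) → ℕ → (Fin m → Fin k → Fin n × Bool) → Fin n → Option Bool)
    (dm : Finset (Fin m) → ℕ → (Fin m → Fin k → Fin n × Bool) → Fin n → Bool)
    (h0 : ∀ (S : Finset (Fin m)) (Φ : Fin m → Fin k → Fin n × Bool) (v : Fin n), st S 0 Φ v = none)
    (hstep : ∀ (S : Finset (Fin m)) (t : ℕ) (Φ : Fin m → Fin k → Fin n × Bool) (v : Fin n),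
      st S (t + 1) Φ v =
        if st S t Φ v = none then
          (if ∃ i : Fin m, i ∉ S ∧ ∃ j : Fin k, (Φ i j).1 = v ∧ ∀ j' : Fin k, j' ≠ j →
              st S t Φ (Φ i j').1 ≠ none ∧ st S t Φ (Φ i j').1 ≠ some (Φ i j').2
            then some (dm S t Φ v)
            else if (v : ℕ) * R / n = t then some true else none)
        else st S t Φ v)
    (hdm : ∀ (S : Finset (Fin m)) (t : ℕ) (Φ : Fin m → Fin k → Fin n × Bool) (v : Fin n) (i : Fin m)
      (j : Fin k), i ∉ S → (Φ i j).1 = v → st S t Φ v = none →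
      (∀ j' : Fin k, j' ≠ j → st S t Φ (Φ i j').1 ≠ none ∧ st S t Φ (Φ i j').1 ≠ some (Φ i j').2) →
      (∀ i' : Fin m, i' ∉ S → (∃ j₁ : Fin k, (Φ i' j₁).1 = v ∧ ∀ j' : Fin k, j' ≠ j₁ →
        st S t Φ (Φ i' j').1 ≠ none ∧ st S t Φ (Φ i' j').1 ≠ some (Φ i' j').2) → i ≤ i') →
      dm S t Φ v = (Φ i j).2)
    (hk : 2 ≤ k) (hn : 1 ≤ n) (hR : 1 ≤ R)
    (M : ℝ) (hM : ∀ u s : ℕ, u + s = n → (u : ℝ) * (s : ℝ) ^ (k - 2) ≤ M * (n : ℝ) ^ (k - 1))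
    (W : ℝ) (hW : ∀ t : ℕ, ((((univ : Finset (Fin n)).filter fun v : Fin n => (v : ℕ) * R / n = t).card : ℕ) : ℝ) ≤ W)
    (a : ℝ) (ha : 0 ≤ a)
    (hN : ∀ (t : ℕ) (S : Finset (Fin m)), ∑ Φ : Fin m → Fin k → Fin n × Bool,
      (((univ : Finset (Fin m)).filter fun i => i ∉ S ∧ ∃ j : Fin k, st S t Φ (Φ i j).1 = none ∧
        ∀ j' : Fin k, j' ≠ j → st S t Φ (Φ i j').1 ≠ none ∧ st S t Φ (Φ i j').1 ≠ some (Φ i j').2).card : ℝ)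
      ≤ a * Fintype.card (Fin m → Fin k → Fin n × Bool))
    (q : ℝ) (hq0 : 0 ≤ q)
    (hq : ∀ (t : ℕ) (S' : Finset (Fin m)), ∑ Φ : Fin m → Fin k → Fin n × Bool,
      (((univ : Finset (Fin m)).filter fun i => i ∉ S' ∧ ∃ j : Fin k, st S' t Φ (Φ i j).1 = none ∧
        ∀ j' : Fin k, j' ≠ j → st S' t Φ (Φ i j').1 ≠ none ∧ st S' t Φ (Φ i j').1 ≠ some (Φ i j').2).card : ℝ) ^ 2
      ≤ q * Fintype.card (Fin m → Fin k → Fin n × Bool)) :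
    ∑ Φ : Fin m → Fin k → Fin n × Bool,
      (((univ : Finset (Fin m)).filter fun i => ∀ j : Fin k,
        (st ∅ R Φ (Φ i j).1).getD true ≠ (Φ i j).2).card : ℝ)
      ≤ ((R : ℝ) * (((m : ℝ) * m) * ((((k * k - k : ℕ) : ℝ) * (2 * M * (n : ℝ) ^ (k - 1))) *
            ((k * k * (k * k - k) * 2 : ℕ) * (n : ℝ) ^ (k - 2))) * (W ^ 2 + 2 * W * a + q)) /
            (Fintype.card (Fin k → Fin n × Bool) : ℝ) ^ 2 +
          (R : ℝ) * ((m : ℝ) * (((k * k - k : ℕ) : ℝ) * (4 * (2 * (n : ℝ)) ^ (k - 2))) * (W ^ 2 + 2 * W * a + q)) /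
            (Fintype.card (Fin k → Fin n × Bool) : ℝ) +
          (m : ℝ) * (((k * k - k : ℕ) : ℝ) * (2 * (2 * n) ^ (k - 1) : ℕ)) /
            (Fintype.card (Fin k → Fin n × Bool) : ℝ)) *
        Fintype.card (Fin m → Fin k → Fin n × Bool) := by
  haveI : Nonempty (Fin k → Fin n × Bool) := ⟨fun _ => (⟨0, hn⟩, true)⟩
  have hC : (0 : ℝ) < Fintype.card (Fin k → Fin n × Bool) := by exact_mod_cast Fintype.card_pos
  set Ω : ℝ := (Fintype.card (Fin m → Fin k → Fin n × Bool) : ℝ) with hΩ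
  set Cc : ℝ := (Fintype.card (Fin k → Fin n × Bool) : ℝ) with hCc
  have hΩ0 : 0 ≤ Ω := Nat.cast_nonneg _
  have hW0 : 0 ≤ W := le_trans (Nat.cast_nonneg _) (hW 0)
  have hQ0 : 0 ≤ W ^ 2 + 2 * W * a + q := add_nonneg (add_nonneg (sq_nonneg W) (by positivity)) hq0
  have hMn : 0 ≤ M * (n : ℝ) ^ (k - 1) := by
    have := hM 0 n (Nat.zero_add n); simp only [Nat.cast_zero, zero_mul] at this; exact this
  have hK0 : 0 ≤ ((k * k - k : ℕ) : ℝ) * (2 * M * (n : ℝ) ^ (k - 1)) :=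
    mul_nonneg (Nat.cast_nonneg _) (by rw [mul_assoc]; exact mul_nonneg (by norm_num) hMn)
  have hKK0 : 0 ≤ ((m : ℝ) * m) * ((((k * k - k : ℕ) : ℝ) * (2 * M * (n : ℝ) ^ (k - 1))) *
      ((k * k * (k * k - k) * 2 : ℕ) * (n : ℝ) ^ (k - 2))) :=
    mul_nonneg (mul_self_nonneg _) (mul_nonneg hK0 (by positivity))
  -- pointwise classification, summed
  have hpt := fun Φ => sissU_card_violated_le st dm h0 hstep hdm (by omega) hR Φ
  refine (sum_le_sum fun Φ _ => hpt Φ).trans ?_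
  rw [sum_add_distrib, sum_add_distrib, add_mul, add_mul]
  refine add_le_add (add_le_add ?_ ?_) ?_
  · -- kind A: contradiction pairs, `t = 0` contributes nothing
    rw [sum_comm]
    have hterm : ∀ t ∈ range R, ∑ Φ : Fin m → Fin k → Fin n × Bool, ∑ i : Fin m, ∑ i' : Fin m,
        (if i ≠ i' ∧ ∃ v : Fin n,
            (∃ j : Fin k, (Φ i j).1 = v ∧ st ∅ t Φ v = none ∧ ∀ j' : Fin k, j' ≠ j →
              st ∅ t Φ (Φ i j').1 ≠ none ∧ st ∅ t Φ (Φ i j').1 ≠ some (Φ i j').2) ∧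
            (∃ j : Fin k, (Φ i' j).1 = v ∧ st ∅ t Φ v = none ∧ ∀ j' : Fin k, j' ≠ j →
              st ∅ t Φ (Φ i' j').1 ≠ none ∧ st ∅ t Φ (Φ i' j').1 ≠ some (Φ i' j').2)
          then (1 : ℝ) else 0)
        ≤ (((m : ℝ) * m) * ((((k * k - k : ℕ) : ℝ) * (2 * M * (n : ℝ) ^ (k - 1))) *
            ((k * k * (k * k - k) * 2 : ℕ) * (n : ℝ) ^ (k - 2))) * (W ^ 2 + 2 * W * a + q)) / Cc ^ 2 * Ω := by
      intro t _
      -- rewrite the double sum over `i ≠ i'` as a sum over the off-diagonal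
      have hoff : ∀ Φ : Fin m → Fin k → Fin n × Bool, ∑ i : Fin m, ∑ i' : Fin m,
          (if i ≠ i' ∧ ∃ v : Fin n,
              (∃ j : Fin k, (Φ i j).1 = v ∧ st ∅ t Φ v = none ∧ ∀ j' : Fin k, j' ≠ j →
                st ∅ t Φ (Φ i j').1 ≠ none ∧ st ∅ t Φ (Φ i j').1 ≠ some (Φ i j').2) ∧
              (∃ j : Fin k, (Φ i' j).1 = v ∧ st ∅ t Φ v = none ∧ ∀ j' : Fin k, j' ≠ j →
                st ∅ t Φ (Φ i' j').1 ≠ none ∧ st ∅ t Φ (Φ i' j').1 ≠ some (Φ i' j').2)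
            then (1 : ℝ) else 0)
          = ∑ p ∈ (univ : Finset (Fin m)).offDiag,
            (if (p.1 ∉ (∅ : Finset (Fin m)) ∧ p.2 ∉ (∅ : Finset (Fin m))) ∧ ∃ v : Fin n,
                (∃ j : Fin k, (Φ p.1 j).1 = v ∧ st ∅ t Φ v = none ∧ ∀ j' : Fin k, j' ≠ j →
                  st ∅ t Φ (Φ p.1 j').1 ≠ none ∧ st ∅ t Φ (Φ p.1 j').1 ≠ some (Φ p.1 j').2) ∧
                (∃ j : Fin k, (Φ p.2 j).1 = v ∧ st ∅ t Φ v = none ∧ ∀ j' : Fin k, j' ≠ j →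
                  st ∅ t Φ (Φ p.2 j').1 ≠ none ∧ st ∅ t Φ (Φ p.2 j').1 ≠ some (Φ p.2 j').2)
              then (1 : ℝ) else 0) := by
        intro Φ
        rw [← Fintype.sum_prod_type']
        have hod : (univ : Finset (Fin m)).offDiag =
            (univ : Finset (Fin m × Fin m)).filter (fun p : Fin m × Fin m => p.1 ≠ p.2) := by
          ext p
          simp only [mem_offDiag, mem_univ, true_and, mem_filter]
        rw [hod, sum_filter]
        refine sum_congr rfl fun p _ => ?_
        by_cases hp : p.1 ≠ p.2
        · rw [if_pos hp]
          have he : p.1 ∉ (∅ : Finset (Fin m)) ∧ p.2 ∉ (∅ : Finset (Fin m)) := ⟨by simp, by simp⟩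
          simp only [hp, he, not_false_eq_true, true_and, ne_eq]
        · rw [if_neg (fun h => hp h.1), if_neg hp]
      simp_rw [hoff]
      rcases Nat.eq_zero_or_pos t with rfl | htpos
      · -- no unit clause at round 0
        have hz : ∀ Φ : Fin m → Fin k → Fin n × Bool, ∑ p ∈ (univ : Finset (Fin m)).offDiag,
            (if (p.1 ∉ (∅ : Finset (Fin m)) ∧ p.2 ∉ (∅ : Finset (Fin m))) ∧ ∃ v : Fin n,
                (∃ j : Fin k, (Φ p.1 j).1 = v ∧ st ∅ 0 Φ v = none ∧ ∀ j' : Fin k, j' ≠ j →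
                  st ∅ 0 Φ (Φ p.1 j').1 ≠ none ∧ st ∅ 0 Φ (Φ p.1 j').1 ≠ some (Φ p.1 j').2) ∧
                (∃ j : Fin k, (Φ p.2 j).1 = v ∧ st ∅ 0 Φ v = none ∧ ∀ j' : Fin k, j' ≠ j →
                  st ∅ 0 Φ (Φ p.2 j').1 ≠ none ∧ st ∅ 0 Φ (Φ p.2 j').1 ≠ some (Φ p.2 j').2)
              then (1 : ℝ) else 0) = 0 := by
          intro Φ
          refine sum_eq_zero fun p _ => ?_
          rw [if_neg]
          rintro ⟨-, v, hu, -⟩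
          exact sissU_not_unit_zero st h0 hk ∅ Φ p.1 v hu
        simp only [hz, sum_const_zero]
        exact mul_nonneg (div_nonneg (mul_nonneg hKK0 hQ0) (sq_nonneg _)) hΩ0
      · obtain ⟨t', rfl⟩ : ∃ t', t = t' + 1 := ⟨t - 1, by omega⟩
        have hcp := sissU_sum_cpairs_le st dm h0 hstep hdm M hM W hW a hN q t' (hq t') ∅
        rw [div_mul_eq_mul_div, le_div_iff₀ (by positivity)]
        calc (∑ Φ : Fin m → Fin k → Fin n × Bool, ∑ p ∈ (univ : Finset (Fin m)).offDiag,
              (if (p.1 ∉ (∅ : Finset (Fin m)) ∧ p.2 ∉ (∅ : Finset (Fin m))) ∧ ∃ v : Fin n,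
                  (∃ j : Fin k, (Φ p.1 j).1 = v ∧ st ∅ (t' + 1) Φ v = none ∧ ∀ j' : Fin k, j' ≠ j →
                    st ∅ (t' + 1) Φ (Φ p.1 j').1 ≠ none ∧ st ∅ (t' + 1) Φ (Φ p.1 j').1 ≠ some (Φ p.1 j').2) ∧
                  (∃ j : Fin k, (Φ p.2 j).1 = v ∧ st ∅ (t' + 1) Φ v = none ∧ ∀ j' : Fin k, j' ≠ j →
                    st ∅ (t' + 1) Φ (Φ p.2 j').1 ≠ none ∧ st ∅ (t' + 1) Φ (Φ p.2 j').1 ≠ some (Φ p.2 j').2)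
                then (1 : ℝ) else 0)) * Cc ^ 2
            = Cc ^ 2 * (∑ Φ : Fin m → Fin k → Fin n × Bool, ∑ p ∈ (univ : Finset (Fin m)).offDiag,
              (if (p.1 ∉ (∅ : Finset (Fin m)) ∧ p.2 ∉ (∅ : Finset (Fin m))) ∧ ∃ v : Fin n,
                  (∃ j : Fin k, (Φ p.1 j).1 = v ∧ st ∅ (t' + 1) Φ v = none ∧ ∀ j' : Fin k, j' ≠ j →
                    st ∅ (t' + 1) Φ (Φ p.1 j').1 ≠ none ∧ st ∅ (t' + 1) Φ (Φ p.1 j').1 ≠ some (Φ p.1 j').2) ∧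
                  (∃ j : Fin k, (Φ p.2 j).1 = v ∧ st ∅ (t' + 1) Φ v = none ∧ ∀ j' : Fin k, j' ≠ j →
                    st ∅ (t' + 1) Φ (Φ p.2 j').1 ≠ none ∧ st ∅ (t' + 1) Φ (Φ p.2 j').1 ≠ some (Φ p.2 j').2)
                then (1 : ℝ) else 0)) := by ring
          _ ≤ _ := hcp
          _ = _ := by rw [hΩ]; ring
    refine (sum_le_sum hterm).trans (le_of_eq ?_)
    rw [sum_const, card_range, nsmul_eq_mul]
    ring
  · -- kind B: collisions
    rw [sum_comm]
    have hterm : ∀ t ∈ range R, ∑ Φ : Fin m → Fin k → Fin n × Bool, ∑ i : Fin m,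
        (if ∃ j j' : Fin k, (Φ i j).1 ≠ (Φ i j').1 ∧ st ∅ t Φ (Φ i j).1 = none ∧ st ∅ t Φ (Φ i j').1 = none ∧
            st ∅ (t + 1) Φ (Φ i j).1 ≠ none ∧ st ∅ (t + 1) Φ (Φ i j').1 ≠ none then (1 : ℝ) else 0)
        ≤ ((m : ℝ) * (((k * k - k : ℕ) : ℝ) * (4 * (2 * (n : ℝ)) ^ (k - 2))) * (W ^ 2 + 2 * W * a + q)) / Cc * Ω := by
      intro t _
      rw [sum_comm]
      have hi : ∀ i ∈ (univ : Finset (Fin m)), ∑ Φ : Fin m → Fin k → Fin n × Bool,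
          (if ∃ j j' : Fin k, (Φ i j).1 ≠ (Φ i j').1 ∧ st ∅ t Φ (Φ i j).1 = none ∧ st ∅ t Φ (Φ i j').1 = none ∧
              st ∅ (t + 1) Φ (Φ i j).1 ≠ none ∧ st ∅ (t + 1) Φ (Φ i j').1 ≠ none then (1 : ℝ) else 0)
          ≤ ((((k * k - k : ℕ) : ℝ) * (4 * (2 * (n : ℝ)) ^ (k - 2))) * (W ^ 2 + 2 * W * a + q)) / Cc * Ω := by
        intro i _
        have h1 := sissU_sum_collision_indicator_le st dm h0 hstep hdm ∅ t i (by simp)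
        have hnew := sissU_sum_new_sq_le st dm hstep W hW a hN q t (insert i ∅) (hq t (insert i ∅))
        have h2 : ∑ Φ : Fin m → Fin k → Fin n × Bool,
            ((((2 * ((univ : Finset (Fin n)).filter fun w => st (insert i ∅) t Φ w = none ∧
                st (insert i ∅) (t + 1) Φ w ≠ none).card) *
              (2 * ((univ : Finset (Fin n)).filter fun w => st (insert i ∅) t Φ w = none ∧
                st (insert i ∅) (t + 1) Φ w ≠ none).card) * (2 * n) ^ (k - 2)) : ℕ) : ℝ)
            ≤ 4 * (2 * (n : ℝ)) ^ (k - 2) * ((W ^ 2 + 2 * W * a + q) * Ω) := by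
          have heq : ∀ Φ : Fin m → Fin k → Fin n × Bool,
              ((((2 * ((univ : Finset (Fin n)).filter fun w => st (insert i ∅) t Φ w = none ∧
                  st (insert i ∅) (t + 1) Φ w ≠ none).card) *
                (2 * ((univ : Finset (Fin n)).filter fun w => st (insert i ∅) t Φ w = none ∧
                  st (insert i ∅) (t + 1) Φ w ≠ none).card) * (2 * n) ^ (k - 2)) : ℕ) : ℝ)
              = 4 * (2 * (n : ℝ)) ^ (k - 2) *
                ((((univ : Finset (Fin n)).filter fun w => st (insert i ∅) t Φ w = none ∧
                  st (insert i ∅) (t + 1) Φ w ≠ none).card : ℕ) : ℝ) ^ 2 := by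
            intro Φ; push_cast; ring
          simp_rw [heq]
          rw [← mul_sum]
          exact mul_le_mul_of_nonneg_left hnew (by positivity)
        rw [div_mul_eq_mul_div, le_div_iff₀ hC]
        calc (∑ Φ : Fin m → Fin k → Fin n × Bool,
              (if ∃ j j' : Fin k, (Φ i j).1 ≠ (Φ i j').1 ∧ st ∅ t Φ (Φ i j).1 = none ∧ st ∅ t Φ (Φ i j').1 = none ∧
                  st ∅ (t + 1) Φ (Φ i j).1 ≠ none ∧ st ∅ (t + 1) Φ (Φ i j').1 ≠ none then (1 : ℝ) else 0)) * Cc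
            = Cc * ∑ Φ : Fin m → Fin k → Fin n × Bool,
              (if ∃ j j' : Fin k, (Φ i j).1 ≠ (Φ i j').1 ∧ st ∅ t Φ (Φ i j).1 = none ∧ st ∅ t Φ (Φ i j').1 = none ∧
                  st ∅ (t + 1) Φ (Φ i j).1 ≠ none ∧ st ∅ (t + 1) Φ (Φ i j').1 ≠ none then (1 : ℝ) else 0) :=
              mul_comm _ _
          _ ≤ _ := h1
          _ ≤ ((k * k - k : ℕ) : ℝ) * (4 * (2 * (n : ℝ)) ^ (k - 2) * ((W ^ 2 + 2 * W * a + q) * Ω)) :=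
              mul_le_mul_of_nonneg_left h2 (Nat.cast_nonneg _)
          _ = _ := by ring
      refine (sum_le_sum hi).trans (le_of_eq ?_)
      rw [sum_const, card_univ, Fintype.card_fin, nsmul_eq_mul]
      ring
    refine (sum_le_sum hterm).trans (le_of_eq ?_)
    rw [sum_const, card_range, nsmul_eq_mul]
    ring
  · -- kind C: degenerate
    rw [sum_comm]
    have hi : ∀ i ∈ (univ : Finset (Fin m)), ∑ Φ : Fin m → Fin k → Fin n × Bool,
        (if ∃ j j' : Fin k, j ≠ j' ∧ (Φ i j).1 = (Φ i j').1 then (1 : ℝ) else 0)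
        ≤ (((k * k - k : ℕ) : ℝ) * (2 * (2 * n) ^ (k - 1) : ℕ)) / Cc * Ω := by
      intro i _
      have h1 := sissU_sum_degenerate_indicator_le (m := m) (k := k) hn i
      rw [div_mul_eq_mul_div, le_div_iff₀ hC, mul_comm]
      exact h1
    refine (sum_le_sum hi).trans (le_of_eq ?_)
    rw [sum_const, card_univ, Fintype.card_fin, nsmul_eq_mul]
    ring

end Main


end Summit.PneNP.PneNP.Theorems
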